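import Literature.AlgebraicGeometry.Resolution.MarkedIdeals
import Mathlib.AlgebraicGeometry.Noetherian
import Mathlib.RingTheory.Localization.AtPrime.Basic
import Mathlib.RingTheory.Localization.Ideal
import HarnessLib

/-!
# A germ generating the stalk of a coherent ideal sheaf generates it on a neighbourhood

Topic: `Literature/AlgebraicGeometry/Resolution`. A spreading-out lemma for (quasi-coherent)
ideal sheaves `I` (Mathlib's `Scheme.IdealSheafData`, sections on affine opens) on a locally
Noetherian scheme `X`, in the vocabulary of `MarkedIdeals.lean` (`stalkIdeal I x = I_x ⊆ 𝒪_{X,x}`):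

**if the germ at `v` of a section `f ∈ Γ(X, U)` (`U ∋ v` affine) generates the stalk
`I_v = (f_v)`, then `f` generates `I` on a basic open neighbourhood `D(r) ∋ v`, `r ∈ Γ(X, U)`:**

* `exists_basicOpen_ideal_eq_span` — sections: `I(D(r)) = (f|_{D(r)})`;
* `exists_basicOpen_forall_stalkIdeal_eq_span_germ`, `exists_forall_stalkIdeal_eq_span_germ` —
  stalks: `I_w = (f_w)` for every `w ∈ D(r)` (resp. for every `w` in an affine open
  neighbourhood `W ⊆ U` of `v`);
* `mem_support_iff_mem_maximalIdeal_of_stalkIdeal_eq` — at such a point, `w ∈ Supp(𝒪_X/I)` iff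
  `f_w ∈ 𝔪_w`; packaged with the above in
  `exists_forall_stalkIdeal_eq_span_germ_and_mem_support_iff`, and set-theoretically in
  `exists_basicOpen_support_inter_eq_zeroLocus_inter` — `Supp(𝒪_X/I) ∩ D(r) = V(f) ∩ D(r)`.

This is the special case "one generator, ideal sheaves" of the standard Nakayama-type statement
that finitely many sections of a module of finite type whose germs generate the stalk at a point
generate the module on a neighbourhood (Görtz–Wedhorn, Prop. 7.30; EGA 0_I §5.2). Note that `f`
is NOT assumed to be a section of `I` over `U` — only its germ lies in `I_v` — so the proof first
clears a denominator: `s · f ∈ I(U)` for some `s ∉ 𝔭_v`.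

Proof (inside the Noetherian ring `A = Γ(X, U)`, whose localization at the prime `𝔭 = 𝔭_v` of
`v` is `𝒪_{X,v}`, `IsAffineOpen.isLocalization_stalk`): `I(U) = (g_1, …, g_n)` is finitely
generated; `I(U) A_𝔭 = (f) A_𝔭` gives `s ∉ 𝔭` with `s f ∈ I(U)` and `t_k ∉ 𝔭` with
`t_k g_k ∈ (f)` (`IsLocalization.algebraMap_mem_map_algebraMap_iff`); on `D(r)`,
`r = s · ∏ t_k ∉ 𝔭`, all of `s, t_k` are units, whence `I(D(r)) = I(U) Γ(D(r)) = (f)`, and the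
stalk statements follow from `stalkIdeal_eq_map_germ` on the affine open `D(r)`.

Related: `exists_ideal_eq_span_singleton_of_stalkIdeal_eq` (`AlterationsBoundaryDivisor.lean`)
is the sections statement under the extra hypothesis `f ∈ I(U)` (and with a heavier import
chain); the present file assumes only `I_v = (f_v)` and imports only `MarkedIdeals.lean`.

## Sources

* U. Görtz, T. Wedhorn, *Algebraic Geometry I: Schemes*, 2nd ed. (2020), Prop. 7.30 (sections
  whose germs generate the stalk of a module of finite type generate it on a neighbourhood).
  [GortzWedhorn2020]
* A. Grothendieck, J. Dieudonné, *EGA* I (1960), 0_I §5.2 (faisceaux de type fini).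

NOT here: the many-generators / general `𝒪_X`-module version (Mathlib's `Scheme.Modules` API is
not used by `MarkedIdeals.lean`), and any non-Noetherian (finite presentation) refinement.
-/

noncomputable section

open CategoryTheory AlgebraicGeometry TopologicalSpace IsLocalRing

namespace Literature.AlgebraicGeometry.Resolution

universe u

variable {X : Scheme.{u}}

/-! ## From sections to stalks -/

/-- If `I(W) = (f|_W)` on an affine open `W ⊆ U`, then `I_w = (f_w)` at every `w ∈ W`.
[folklore] -/
theorem stalkIdeal_eq_span_germ_of_ideal_eq_span (I : X.IdealSheafData) {U W : X.affineOpens}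
    (hWU : (W : X.Opens) ≤ U) (f : Γ(X, U))
    (hW : I.ideal W = Ideal.span {X.presheaf.map (homOfLE hWU).op f}) {w : X}
    (hw : w ∈ (W : X.Opens)) :
    stalkIdeal I w = Ideal.span {(X.presheaf.germ U w (hWU hw)).hom f} := by
  rw [stalkIdeal_eq_map_germ I W hw, hW, Ideal.map_span, Set.image_singleton]
  congr 2
  change X.presheaf.germ W w hw (X.presheaf.map (homOfLE hWU).op f) = _
  rw [TopCat.Presheaf.germ_res_apply]

/-! ## Spreading out a generator of the stalk -/

/-- **A germ generating `I_v` generates `I` on a basic open neighbourhood (sections).** On a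
locally Noetherian scheme, if `I_v = (f_v)` for a section `f ∈ Γ(X, U)` over an affine open
`U ∋ v`, then `I(D(r)) = (f|_{D(r)})` for some `r ∈ Γ(X, U)` with `v ∈ D(r)`. (`I(U)` is finitely
generated; clear the finitely many denominators in `𝒪_{X,v} = Γ(X, U)_𝔭`.) [folklore] -/
theorem exists_basicOpen_ideal_eq_span [IsLocallyNoetherian X] (I : X.IdealSheafData)
    (U : X.affineOpens) (v : X) (hv : v ∈ (U : X.Opens)) (f : Γ(X, U))
    (h : stalkIdeal I v = Ideal.span {(X.presheaf.germ U v hv).hom f}) :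
    ∃ r : Γ(X, U), v ∈ X.basicOpen r ∧
      I.ideal (X.affineBasicOpen r) =
        Ideal.span {X.presheaf.map (homOfLE (X.basicOpen_le r)).op f} := by
  classical
  haveI : IsNoetherianRing Γ(X, U) := IsLocallyNoetherian.component_noetherian U
  letI alg : Algebra Γ(X, U) (X.presheaf.stalk v) := (X.presheaf.germ U v hv).hom.toAlgebra
  set p : Ideal Γ(X, U) := (U.2.primeIdealOf ⟨v, hv⟩).asIdeal with hp
  haveI : IsLocalization.AtPrime (X.presheaf.stalk v) p := U.2.isLocalization_stalk ⟨v, hv⟩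
  have hp' : p.IsPrime := inferInstance
  -- `I(U) · 𝒪_{X,v} = (f) · 𝒪_{X,v}`
  have hIU : (I.ideal U).map (algebraMap Γ(X, U) (X.presheaf.stalk v)) =
      (Ideal.span {f}).map (algebraMap Γ(X, U) (X.presheaf.stalk v)) := by
    rw [Ideal.map_span, Set.image_singleton]
    change (I.ideal U).map (X.presheaf.germ U v hv).hom =
      Ideal.span {(X.presheaf.germ U v hv).hom f}
    rw [← stalkIdeal_eq_map_germ I U hv, h]
  -- generators `g` of `I(U)` and multipliers `t g ∉ 𝔭` with `t g · g ∈ (f)`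
  obtain ⟨gens, hgens⟩ := (IsNoetherian.noetherian (I.ideal U) : (I.ideal U).FG)
  have h1 : ∀ g ∈ gens, ∃ t : Γ(X, U), t ∉ p ∧ t * g ∈ Ideal.span {f} := by
    intro g hg
    have hmem : algebraMap Γ(X, U) (X.presheaf.stalk v) g ∈
        (Ideal.span {f}).map (algebraMap Γ(X, U) (X.presheaf.stalk v)) := by
      rw [← hIU]
      exact Ideal.mem_map_of_mem _ (hgens ▸ Submodule.subset_span hg)
    rw [IsLocalization.algebraMap_mem_map_algebraMap_iff p.primeCompl] at hmem
    obtain ⟨t, ht, htg⟩ := hmem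
    exact ⟨t, ht, htg⟩
  choose! t ht using h1
  -- a multiplier `s ∉ 𝔭` with `s · f ∈ I(U)`
  have h2 : ∃ s : Γ(X, U), s ∉ p ∧ s * f ∈ I.ideal U := by
    have hmem : algebraMap Γ(X, U) (X.presheaf.stalk v) f ∈
        (I.ideal U).map (algebraMap Γ(X, U) (X.presheaf.stalk v)) := by
      rw [hIU]
      exact Ideal.mem_map_of_mem _ (Ideal.mem_span_singleton_self f)
    rw [IsLocalization.algebraMap_mem_map_algebraMap_iff p.primeCompl] at hmem
    obtain ⟨s, hs, hsf⟩ := hmem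
    exact ⟨s, hs, hsf⟩
  obtain ⟨s, hsp, hsf⟩ := h2
  -- the basic open `D(r)`, `r = s · ∏ t g ∉ 𝔭`
  have htp : (∏ g ∈ gens, t g) ∉ p := fun hmem => by
    obtain ⟨g, hg, htg⟩ := hp'.prod_mem_iff.mp hmem
    exact (ht g hg).1 htg
  set r : Γ(X, U) := s * ∏ g ∈ gens, t g with hr
  have hrp : r ∉ p := fun hmem => (hp'.mem_or_mem hmem).elim hsp htp
  refine ⟨r, ?_, ?_⟩
  · rw [X.mem_basicOpen r v hv]
    exact (IsLocalization.AtPrime.isUnit_to_map_iff (X.presheaf.stalk v) p r).mpr hrp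
  · -- on `D(r)` the multipliers are units
    let res := (X.presheaf.map (homOfLE (X.basicOpen_le r)).op).hom
    letI algL : Algebra Γ(X, U) Γ(X, X.affineBasicOpen r) := res.toAlgebra
    haveI : IsLocalization.Away r Γ(X, X.affineBasicOpen r) := U.2.isLocalization_basicOpen r
    have hunit : ∀ a : Γ(X, U), a ∣ r → IsUnit (res a) := fun a ha =>
      isUnit_of_dvd_unit (map_dvd res ha)
        (IsLocalization.Away.algebraMap_isUnit (S := Γ(X, X.affineBasicOpen r)) r)
    rw [← I.map_ideal_basicOpen U r]
    change (I.ideal U).map res = Ideal.span {res f}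
    apply le_antisymm
    · rw [← hgens, Ideal.map_span, Ideal.span_le]
      rintro _ ⟨g, hg, rfl⟩
      have hg' : g ∈ gens := hg
      rw [SetLike.mem_coe]
      have hmem : res (t g * g) ∈ Ideal.span {res f} := by
        have := Ideal.mem_map_of_mem res (ht g hg').2
        rwa [Ideal.map_span, Set.image_singleton] at this
      rw [map_mul] at hmem
      exact (Ideal.unit_mul_mem_iff_mem _ (hunit (t g) ⟨s * ∏ g' ∈ gens.erase g, t g', by
        rw [hr, ← Finset.mul_prod_erase _ _ hg']; ring⟩)).mp hmem
    · rw [Ideal.span_singleton_le_iff_mem]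
      have hmem : res (s * f) ∈ (I.ideal U).map res := Ideal.mem_map_of_mem res hsf
      rw [map_mul] at hmem
      exact (Ideal.unit_mul_mem_iff_mem _ (hunit s ⟨∏ g ∈ gens, t g, hr⟩)).mp hmem

/-- **A germ generating `I_v` generates the nearby stalks (basic open form).** On a locally
Noetherian scheme, if `I_v = (f_v)` for `f ∈ Γ(X, U)`, `U ∋ v` affine, then `I_w = (f_w)` for all
`w` in some basic open `D(r) ∋ v`, `r ∈ Γ(X, U)`. [folklore] -/
theorem exists_basicOpen_forall_stalkIdeal_eq_span_germ [IsLocallyNoetherian X]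
    (I : X.IdealSheafData) (U : X.affineOpens) (v : X) (hv : v ∈ (U : X.Opens)) (f : Γ(X, U))
    (h : stalkIdeal I v = Ideal.span {(X.presheaf.germ U v hv).hom f}) :
    ∃ r : Γ(X, U), v ∈ X.basicOpen r ∧ ∀ (w : X) (hw : w ∈ X.basicOpen r),
      stalkIdeal I w = Ideal.span {(X.presheaf.germ U w (X.basicOpen_le r hw)).hom f} := by
  obtain ⟨r, hvr, hr⟩ := exists_basicOpen_ideal_eq_span I U v hv f h
  exact ⟨r, hvr, fun w hw =>
    stalkIdeal_eq_span_germ_of_ideal_eq_span I (W := X.affineBasicOpen r) (X.basicOpen_le r) f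
      hr hw⟩

/-- **A germ generating `I_v` generates the nearby stalks.** On a locally Noetherian scheme `X`,
let `I` be an ideal sheaf, `U ∋ v` an affine open and `f ∈ Γ(X, U)` a section whose germ
generates the stalk, `I_v = (f_v) ⊆ 𝒪_{X,v}`. Then there is an affine open neighbourhood
`W ⊆ U` of `v` such that `I_w = (f_w)` for every `w ∈ W`. [folklore] -/
theorem exists_forall_stalkIdeal_eq_span_germ [IsLocallyNoetherian X]
    (I : X.IdealSheafData) (U : X.affineOpens) (v : X) (hv : v ∈ (U : X.Opens)) (f : Γ(X, U))
    (h : stalkIdeal I v = Ideal.span {(X.presheaf.germ U v hv).hom f}) :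
    ∃ (W : X.affineOpens) (hWU : (W : X.Opens) ≤ U), v ∈ (W : X.Opens) ∧
      ∀ (w : X) (hw : w ∈ (W : X.Opens)),
        stalkIdeal I w = Ideal.span {(X.presheaf.germ U w (hWU hw)).hom f} := by
  obtain ⟨r, hvr, hr⟩ := exists_basicOpen_forall_stalkIdeal_eq_span_germ I U v hv f h
  exact ⟨X.affineBasicOpen r, X.basicOpen_le r, hvr, fun w hw => hr w hw⟩

/-! ## The support near a point where the stalk is principal -/

/-- If `I_x = (g)` then `x ∈ Supp(𝒪_X/I)` iff `g ∈ 𝔪_x` (as `x ∈ Supp(𝒪_X/I) ↔ I_x ⊆ 𝔪_x`,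
`mem_support_iff_stalkIdeal_le`). [folklore] -/
theorem mem_support_iff_mem_maximalIdeal_of_stalkIdeal_eq (I : X.IdealSheafData) {x : X}
    {g : X.presheaf.stalk x} (h : stalkIdeal I x = Ideal.span {g}) :
    x ∈ I.support ↔ g ∈ maximalIdeal (X.presheaf.stalk x) := by
  rw [mem_support_iff_stalkIdeal_le, h, Ideal.span_singleton_le_iff_mem]

/-- **Stalks and support near a point where a germ generates.** On a locally Noetherian scheme,
if `I_v = (f_v)` for `f ∈ Γ(X, U)`, `U ∋ v` affine, then on some affine open neighbourhood
`W ⊆ U` of `v`: `I_w = (f_w)` and `w ∈ Supp(𝒪_X/I) ↔ f_w ∈ 𝔪_w`, for every `w ∈ W`.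
[folklore] -/
theorem exists_forall_stalkIdeal_eq_span_germ_and_mem_support_iff [IsLocallyNoetherian X]
    (I : X.IdealSheafData) (U : X.affineOpens) (v : X) (hv : v ∈ (U : X.Opens)) (f : Γ(X, U))
    (h : stalkIdeal I v = Ideal.span {(X.presheaf.germ U v hv).hom f}) :
    ∃ (W : X.affineOpens) (hWU : (W : X.Opens) ≤ U), v ∈ (W : X.Opens) ∧
      ∀ (w : X) (hw : w ∈ (W : X.Opens)),
        stalkIdeal I w = Ideal.span {(X.presheaf.germ U w (hWU hw)).hom f} ∧
          (w ∈ I.support ↔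
            (X.presheaf.germ U w (hWU hw)).hom f ∈ maximalIdeal (X.presheaf.stalk w)) := by
  obtain ⟨W, hWU, hvW, hW⟩ := exists_forall_stalkIdeal_eq_span_germ I U v hv f h
  exact ⟨W, hWU, hvW, fun w hw =>
    ⟨hW w hw, mem_support_iff_mem_maximalIdeal_of_stalkIdeal_eq I (hW w hw)⟩⟩

/-- **Near a point where a germ `f_v` generates `I_v`, the support of `𝒪_X/I` is the zero locus
of `f`:** `Supp(𝒪_X/I) ∩ D(r) = V(f) ∩ D(r)` for some basic open `D(r) ∋ v`, `r ∈ Γ(X, U)`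
(locally Noetherian `X`, affine `U ∋ v`, `f ∈ Γ(X, U)`). [folklore] -/
theorem exists_basicOpen_support_inter_eq_zeroLocus_inter [IsLocallyNoetherian X]
    (I : X.IdealSheafData) (U : X.affineOpens) (v : X) (hv : v ∈ (U : X.Opens)) (f : Γ(X, U))
    (h : stalkIdeal I v = Ideal.span {(X.presheaf.germ U v hv).hom f}) :
    ∃ r : Γ(X, U), v ∈ X.basicOpen r ∧
      (I.support : Set X) ∩ X.basicOpen r = X.zeroLocus {f} ∩ X.basicOpen r := by
  obtain ⟨r, hvr, hr⟩ := exists_basicOpen_forall_stalkIdeal_eq_span_germ I U v hv f h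
  refine ⟨r, hvr, Set.ext fun w => ?_⟩
  simp only [Set.mem_inter_iff]
  refine ⟨fun ⟨hwI, hw⟩ => ⟨?_, hw⟩, fun ⟨hwf, hw⟩ => ⟨?_, hw⟩⟩
  · rw [Scheme.mem_zeroLocus_iff]
    intro f' hf'
    rw [Set.mem_singleton_iff.mp hf', X.mem_basicOpen f w (X.basicOpen_le r hw)]
    have := (mem_support_iff_mem_maximalIdeal_of_stalkIdeal_eq I (hr w hw)).mp hwI
    exact (IsLocalRing.mem_maximalIdeal _).mp this
  · rw [Scheme.mem_zeroLocus_iff] at hwf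
    have hwf' := hwf f rfl
    rw [X.mem_basicOpen f w (X.basicOpen_le r hw)] at hwf'
    exact (mem_support_iff_mem_maximalIdeal_of_stalkIdeal_eq I (hr w hw)).mpr
      ((IsLocalRing.mem_maximalIdeal _).mpr hwf')

end Literature.AlgebraicGeometry.Resolution
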